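import Literature.AlgebraicGeometry.Frobenioids.FiberProductsLifts
import HarnessLib

/-!
# Frobenioids I, Proposition 1.6 (ii), second half: `C ×_D D′` is a Frobenioid
# (STEP-0 calibration fragment of the abc-iut cell — "routine verification" genre)

Mochizuki, *The geometry of Frobenioids I: the general theory*, Kyushu J. Math. **62** (2008)
293–400, §1, Proposition 1.6 (ii) and the last sentence of its proof, kurims text p. 28
[cite: MochizukiFrdI2008, Prop. 1.6]:

> "(ii) The categorical fiber product `C′ := C ×_D D′` equipped with the functor `C′ → F_{Φ′}`
> […] is a Frobenioid. […] In light of these equivalences, the conditions of Definition 1.3 follow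
> via a routine verification. Thus, `C′` is a Frobenioid."

This file performs the "routine verification": the nineteen clauses of Definition 1.3
(`PreFrobenioid.IsFrobenioid`) for `C′ → F_{Φ′}`, each by projecting to `C`, invoking the
corresponding clause for `C`, and lifting the answer back to `C′` along the identifications
`α : A_D ≅ D′→D (A′)` (the equivalences of Prop. 1.6 (iii)–(v) proved in `FiberProducts*.lean`
are the dictionary; the lifting lemmas `w_of_comp`, `w_of_comp_right` of `FiberProductsLifts.lean` carry
the bookkeeping of the compatibility squares). No statement of the paper is strengthened.
-/

namespace Literature.AlgebraicGeometry.Frobenioids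

open CategoryTheory Opposite

universe w v v' v'' u u' u''

namespace PreFrobenioid

variable {D : Type u} [Category.{v} D] {D' : Type u'} [Category.{v'} D']
  {Φ : Dᵒᵖ ⥤ CommMonCat.{w}} {C : Type u''} [Category.{v''} C]
  {F : C ⥤ ElemFrobenioid Φ} {G : D' ⥤ D}


open FiberProduct in
/-- **FrdI Prop. 1.6 (ii)**, the verification proper: once `C′ = C ×_D D′ → F_{Φ′}` is a
pre-Frobenioid, the conditions (i)–(vii) of Definition 1.3 "follow via a routine verification" from
those of `C`. (This form takes the pre-Frobenioid structure as a hypothesis, so that it also serves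
base changes `D′ → D` for which `Φ′` is a monoid on `D′` for other reasons than the printed
"maps FSM-morphisms to FSM-morphisms", e.g. [FrdII] Ex. 3.3 (ii).) [cite: MochizukiFrdI2008, Prop. 1.6] -/
theorem isFrobenioid_fiberProduct_of_isPreFrobenioid (hF : IsFrobenioid F)
    (hP2 : IsPreFrobenioid (restrictMonoid Φ G) (fiberProductFunctor F G)) :
    IsFrobenioid (fiberProductFunctor F G) := by
  have hP : IsPreFrobenioid Φ F := hF.isPreFrobenioid
  have hD : IsTotallyEpimorphic D := hP.isTotallyEpimorphic_base
  have hC : IsTotallyEpimorphic C := hP.isTotallyEpimorphic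
  refine
    { isPreFrobenioid := hP2
      i_a := ?_, i_b := ?_, i_c := ?_, ii_exists := ?_, ii_unique := ?_, iii_a := ?_, iii_b := ?_,
      iii_c := ?_, iii_c_base := ?_, iii_d_under_full := ?_, iii_d_under_surj := ?_,
      iii_d_over_full := ?_, iii_d_over_surj := ?_, iv_a_exists := ?_, iv_a_unique := ?_,
      iv_b := ?_, v_a := ?_, v_b_exists := ?_, v_b_unique := ?_, v_c_exists := ?_,
      v_c_unique := ?_, vi := ?_, vii_a := ?_, vii_b := ?_ }
  -- (i)(a)
  · intro A₀'
    obtain ⟨A, hA, ⟨α⟩⟩ := hF.i_a (G.obj A₀')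
    exact ⟨⟨A, A₀', α⟩, isFrobeniusTrivial_fiberProduct_of_fst hF _ hA, ⟨Iso.refl _⟩⟩
  -- (i)(b)
  · intro X Y j
    let j₀ : X.snd ≅ Y.snd := j
    obtain ⟨W₀, φ₀, ψ₀, hφ₀, hψ₀, hb⟩ := hF.i_b X.fst Y.fst (X.e ≪≫ G.mapIso j₀ ≪≫ Y.e.symm)
    have hb' : Base F φ₀ ≫ X.e.hom ≫ G.map j₀.hom ≫ Y.e.inv = Base F ψ₀ := hb
    have w : Base F ψ₀ ≫ Y.e.hom = (Base F φ₀ ≫ X.e.hom) ≫ G.map j₀.hom := by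
      rw [← hb']
      simp only [Category.assoc, Iso.inv_hom_id, Category.comp_id]
    refine ⟨liftSrc X φ₀ hφ₀.2, liftSrcHom X φ₀ hφ₀.2, ⟨ψ₀, j₀.hom, w⟩,
      ⟨hφ₀.1, show IsIso (𝟙 X.snd) from inferInstance⟩, ⟨hψ₀.1, show IsIso j₀.hom from inferInstance⟩,
      ?_⟩
    show 𝟙 X.snd ≫ j₀.hom = j₀.hom
    rw [Category.id_comp]
  -- (i)(c)
  · intro X
    haveI := pullbackSliceToBase_faithful (fiberProductFunctor F G) X
    haveI := pullbackSliceToBase_full (fiberProductFunctor F G) X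
    haveI : (pullbackSliceToBase (fiberProductFunctor F G) X).EssSurj := by
      refine ⟨fun Y₀ => ?_⟩
      let e' : Y₀.left ⟶ X.snd := Y₀.hom
      haveI := hF.i_c X.fst
      obtain ⟨P, ⟨e⟩⟩ :=
        Functor.EssSurj.mem_essImage (pullbackSliceToBase F X.fst) (Over.mk (G.map e' ≫ X.e.inv))
      let i : baseObj F P.left.obj ≅ G.obj Y₀.left := (Over.forget _).mapIso e
      have hw : i.hom ≫ (G.map e' ≫ X.e.inv) = Base F P.hom.1 := Over.w e.hom
      have w' : Base F P.hom.1 ≫ X.e.hom = i.hom ≫ G.map e' := by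
        rw [← hw]
        simp only [Category.assoc, Iso.inv_hom_id, Category.comp_id]
      let W : FiberProduct F G := ⟨P.left.obj, Y₀.left, i⟩
      let X' : FiberProduct F G := ⟨X.fst, X.snd, X.e⟩
      let g : W ⟶ X' := ⟨P.hom.1, e', w'⟩
      have hg : IsPullbackMorphism (fiberProductFunctor F G) g :=
        isPullbackMorphism_fiberProduct_of_fst g P.hom.2
      exact ⟨Over.mk (⟨g, hg⟩ : (⟨W⟩ : PullbackCat (fiberProductFunctor F G)) ⟶ ⟨X⟩),
        ⟨Over.isoMk (Iso.refl _) (Category.id_comp _)⟩⟩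
    exact {}
  -- (ii) existence
  · intro X n
    obtain ⟨B, φ₀, hφ₀, hn⟩ := hF.ii_exists X.fst n
    haveI : IsIso (Base F φ₀) := hφ₀.2
    refine ⟨liftTgt X φ₀ hφ₀.2, liftTgtHom X φ₀ hφ₀.2, ?_, hn⟩
    exact (isFrobeniusType_fiberProduct_iff hF (liftTgtHom X φ₀ hφ₀.2)
      (show IsIso (𝟙 X.snd) from inferInstance)).mpr hφ₀
  -- (ii) uniqueness
  · intro X Y Y' φ ψ hφ hψ hn
    haveI : IsIso φ.snd := hφ.2
    haveI : IsIso ψ.snd := hψ.2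
    obtain ⟨β₀, hβ₀⟩ := hF.ii_unique φ.fst ψ.fst ((isFrobeniusType_fiberProduct_iff hF φ hφ.2).mp hφ)
      ((isFrobeniusType_fiberProduct_iff hF ψ hψ.2).mp hψ) hn
    refine ⟨CFP.isoMk β₀ (asIso (inv φ.snd ≫ ψ.snd)) (w_of_comp hD φ ψ β₀.hom hβ₀), ?_⟩
    exact comp_liftCod hD φ ψ β₀.hom hβ₀
  -- (iii)(a)
  · intro X Y Z f g hf hg
    exact (isCoAngular_fiberProduct_iff hF (f ≫ g)).mpr
      (hF.iii_a f.fst g.fst ((isCoAngular_fiberProduct_iff hF f).mp hf)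
        ((isCoAngular_fiberProduct_iff hF g).mp hg))
  -- (iii)(b)
  · intro X' X φ hφ ψ
    haveI : IsIso φ.snd := hφ.2.2
    exact (isCoAngular_fiberProduct_iff hF ψ).mpr
      (hF.iii_b φ.fst ⟨(isCoAngular_fiberProduct_iff hF φ).mp hφ.1,
        (isPreStep_fiberProduct_iff φ hφ.2.2).mp hφ.2⟩ ψ.fst)
  -- (iii)(c)
  · intro X Y φ hφ
    haveI : IsIso φ.snd := hφ.2.2
    have hφC : IsCoAngularPreStep F φ.fst :=
      ⟨(isCoAngular_fiberProduct_iff hF φ).mp hφ.1, (isPreStep_fiberProduct_iff φ hφ.2.2).mp hφ.2⟩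
    obtain ⟨e₀, he₀⟩ := hF.iii_c φ.fst hφC
    refine ⟨(endSubmonoidEquiv X).trans (e₀.trans (endSubmonoidEquiv Y).symm), fun a => ?_⟩
    have ha : CFP.Hom.snd a.1 = 𝟙 X.snd := a.2.1
    refine CFP.hom_ext (he₀ (endSubmonoidEquiv X a)) ?_
    show φ.snd ≫ 𝟙 Y.snd = CFP.Hom.snd a.1 ≫ φ.snd
    rw [ha, Category.comp_id, Category.id_comp]
  -- (iii)(c), dependence on the base only
  · intro X Y φ φ' hφ hφ' hb a b b' e₁ e₂
    haveI : IsIso φ.snd := hφ.2.2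
    haveI : IsIso φ'.snd := hφ'.2.2
    have hφC : IsCoAngularPreStep F φ.fst :=
      ⟨(isCoAngular_fiberProduct_iff hF φ).mp hφ.1, (isPreStep_fiberProduct_iff φ hφ.2.2).mp hφ.2⟩
    have hφC' : IsCoAngularPreStep F φ'.fst :=
      ⟨(isCoAngular_fiberProduct_iff hF φ').mp hφ'.1, (isPreStep_fiberProduct_iff φ' hφ'.2.2).mp hφ'.2⟩
    have hbC : Base F φ.fst = Base F φ'.fst := base_fst_eq_of_snd_eq hb
    have e₁C : φ.fst ≫ (show Y.fst ⟶ Y.fst from (endSubmonoidEquiv Y b).1) =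
        (show X.fst ⟶ X.fst from (endSubmonoidEquiv X a).1) ≫ φ.fst := congrArg CFP.Hom.fst e₁
    have e₂C : φ'.fst ≫ (show Y.fst ⟶ Y.fst from (endSubmonoidEquiv Y b').1) =
        (show X.fst ⟶ X.fst from (endSubmonoidEquiv X a).1) ≫ φ'.fst := congrArg CFP.Hom.fst e₂
    have key := hF.iii_c_base φ.fst φ'.fst hφC hφC' hbC (endSubmonoidEquiv X a) (endSubmonoidEquiv Y b)
      (endSubmonoidEquiv Y b') e₁C e₂C
    exact (endSubmonoidEquiv Y).injective key
  -- (iii)(d), coslice, full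
  · intro X Y Y' φ φ' hφ hφ' hd
    haveI : IsIso φ.snd := hφ.2.2
    haveI : IsIso φ'.snd := hφ'.2.2
    have hφC : IsCoAngularPreStep F φ.fst :=
      ⟨(isCoAngular_fiberProduct_iff hF φ).mp hφ.1, (isPreStep_fiberProduct_iff φ hφ.2.2).mp hφ.2⟩
    have hφC' : IsCoAngularPreStep F φ'.fst :=
      ⟨(isCoAngular_fiberProduct_iff hF φ').mp hφ'.1, (isPreStep_fiberProduct_iff φ' hφ'.2.2).mp hφ'.2⟩
    have hdC : Div F φ.fst ∣ Div F φ'.fst := by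
      have h₁ : pull Φ X.e.inv (Div F φ.fst) ∣ pull Φ X.e.inv (Div F φ'.fst) := hd
      have h₂ := map_dvd (pull Φ X.e.hom) h₁
      rwa [← pull_comp, ← pull_comp, Iso.hom_inv_id, pull_id, pull_id] at h₂
    obtain ⟨f₀, hf₀, hcomp⟩ := hF.iii_d_under_full φ.fst φ'.fst hφC hφC' hdC
    refine ⟨liftCod hD φ φ' f₀ hcomp, ⟨?_, hf₀.2.1, ?_⟩, comp_liftCod hD φ φ' f₀ hcomp⟩
    · exact (isCoAngular_fiberProduct_iff hF _).mpr hf₀.1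
    · show IsIso (inv φ.snd ≫ φ'.snd)
      infer_instance
  -- (iii)(d), coslice, essentially surjective
  · intro X x
    let x₀ : Φ.obj (op (G.obj X.snd)) := x
    obtain ⟨B, φ₀, hφ₀, hdiv⟩ := hF.iii_d_under_surj X.fst (pull Φ X.e.hom x₀)
    haveI : IsIso (Base F φ₀) := hφ₀.2.2
    refine ⟨liftTgt X φ₀ hφ₀.2.2, liftTgtHom X φ₀ hφ₀.2.2,
      ⟨(isCoAngular_fiberProduct_iff hF _).mpr hφ₀.1, hφ₀.2.1, show IsIso (𝟙 X.snd) from inferInstance⟩,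
      ?_⟩
    show pull Φ X.e.inv (Div F φ₀) = x₀
    rw [hdiv, ← pull_comp, Iso.inv_hom_id, pull_id]
  -- (iii)(d), slice, full
  · intro X Y Y' ψ ψ' hψ hψ' hd
    haveI : IsIso ψ.snd := hψ.2.2
    haveI : IsIso ψ'.snd := hψ'.2.2
    have hψC : IsCoAngularPreStep F ψ.fst :=
      ⟨(isCoAngular_fiberProduct_iff hF ψ).mp hψ.1, (isPreStep_fiberProduct_iff ψ hψ.2.2).mp hψ.2⟩
    have hψC' : IsCoAngularPreStep F ψ'.fst :=
      ⟨(isCoAngular_fiberProduct_iff hF ψ').mp hψ'.1, (isPreStep_fiberProduct_iff ψ' hψ'.2.2).mp hψ'.2⟩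
    have hdC : invDiv F ψ'.fst hψC'.2.2 ∣ invDiv F ψ.fst hψC.2.2 := by
      rw [invDiv_eq ψ' hψ'.2.2, invDiv_eq ψ hψ.2.2] at hd
      have h₂ := map_dvd (pull Φ X.e.hom) hd
      rwa [← pull_comp, ← pull_comp, Iso.hom_inv_id, pull_id, pull_id] at h₂
    obtain ⟨g₀, hg₀, hcomp⟩ := hF.iii_d_over_full ψ.fst ψ'.fst hψC hψC' hdC
    refine ⟨liftDom ψ ψ' g₀ hcomp, ⟨?_, hg₀.2.1, ?_⟩, liftDom_comp ψ ψ' g₀ hcomp⟩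
    · exact (isCoAngular_fiberProduct_iff hF _).mpr hg₀.1
    · show IsIso (ψ.snd ≫ inv ψ'.snd)
      infer_instance
  -- (iii)(d), slice, essentially surjective
  · intro X x
    let x₀ : Φ.obj (op (G.obj X.snd)) := x
    obtain ⟨B, ψ₀, hψ₀, hdiv⟩ := hF.iii_d_over_surj X.fst (pull Φ X.e.hom x₀)
    have h : IsCoAngularPreStep (fiberProductFunctor F G) (liftSrcHom X ψ₀ hψ₀.2.2) :=
      ⟨(isCoAngular_fiberProduct_iff hF _).mpr hψ₀.1, hψ₀.2.1, show IsIso (𝟙 X.snd) from inferInstance⟩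
    refine ⟨liftSrc X ψ₀ hψ₀.2.2, liftSrcHom X ψ₀ hψ₀.2.2, h, ?_⟩
    rw [invDiv_eq _ h.2.2]
    show pull Φ X.e.inv (invDiv F ψ₀ _) = x₀
    rw [hdiv, ← pull_comp, Iso.inv_hom_id, pull_id]
  -- (iv)(a) existence
  · intro X Y φ
    obtain ⟨P, Q, c, b, a, hfac, hc, hb, ha⟩ := hF.iv_a_exists φ.fst
    haveI : IsIso (Base F c) := hc.2
    haveI : IsIso (Base F b) := hb.2
    have hfac' : (c ≫ b) ≫ a = φ.fst := by rw [Category.assoc, hfac]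
    let X₁ := liftTgt X c hc.2
    let c' : X ⟶ X₁ := liftTgtHom X c hc.2
    let X₂ := liftTgt X₁ b hb.2
    let b' : X₁ ⟶ X₂ := liftTgtHom X₁ b hb.2
    have hw : Base F a ≫ Y.e.hom = (inv (Base F b) ≫ inv (Base F c) ≫ X.e.hom) ≫ G.map φ.snd := by
      simp only [Category.assoc]
      rw [← hom_w φ, ← hfac]
      simp only [base_comp, Category.assoc, IsIso.inv_hom_id_assoc]
    let a' : X₂ ⟶ Y := ⟨a, φ.snd, hw⟩
    refine ⟨X₁, X₂, c', b', a', ?_, ?_, ⟨hb.1, show IsIso (𝟙 X.snd) from inferInstance⟩,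
      isPullbackMorphism_fiberProduct_of_fst a' ha⟩
    · refine CFP.hom_ext ?_ ?_
      · show c ≫ b ≫ a = φ.fst
        exact hfac
      · show 𝟙 X.snd ≫ 𝟙 X.snd ≫ φ.snd = φ.snd
        rw [Category.id_comp, Category.id_comp]
    · exact (isFrobeniusType_fiberProduct_iff hF c' (show IsIso (𝟙 X.snd) from inferInstance)).mpr hc
  -- (iv)(a) uniqueness
  · intro X Y X₁ Y₁ X₂ Y₂ φ c₁ b₁ a₁ c₂ b₂ a₂ h₁ hc₁ hb₁ ha₁ h₂ hc₂ hb₂ ha₂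
    haveI : IsIso c₁.snd := hc₁.2
    haveI : IsIso c₂.snd := hc₂.2
    haveI : IsIso b₁.snd := hb₁.2
    haveI : IsIso b₂.snd := hb₂.2
    have h₁C : c₁.fst ≫ b₁.fst ≫ a₁.fst = φ.fst := congrArg CFP.Hom.fst h₁
    have h₂C : c₂.fst ≫ b₂.fst ≫ a₂.fst = φ.fst := congrArg CFP.Hom.fst h₂
    obtain ⟨ε₀, δ₀, hε₀, hδ₀, hα₀⟩ := hF.iv_a_unique φ.fst c₁.fst b₁.fst a₁.fst c₂.fst b₂.fst a₂.fst
      h₁C ((isFrobeniusType_fiberProduct_iff hF c₁ hc₁.2).mp hc₁)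
      ((isPreStep_fiberProduct_iff b₁ hb₁.2).mp hb₁) ((isPullbackMorphism_fiberProduct_iff hF a₁).mp ha₁)
      h₂C ((isFrobeniusType_fiberProduct_iff hF c₂ hc₂.2).mp hc₂)
      ((isPreStep_fiberProduct_iff b₂ hb₂.2).mp hb₂) ((isPullbackMorphism_fiberProduct_iff hF a₂).mp ha₂)
    -- `ε`
    have wε := w_of_comp hD c₁ c₂ ε₀.hom hε₀
    let ε : X₁ ≅ X₂ := CFP.isoMk ε₀ (asIso (inv c₁.snd ≫ c₂.snd)) wε
    -- `δ`
    haveI : IsIso (c₁ ≫ b₁).snd := by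
      show IsIso (c₁.snd ≫ b₁.snd)
      infer_instance
    haveI : IsIso (c₂ ≫ b₂).snd := by
      show IsIso (c₂.snd ≫ b₂.snd)
      infer_instance
    have hδ₀' : (c₁ ≫ b₁).fst ≫ δ₀.hom = (c₂ ≫ b₂).fst := by
      show (c₁.fst ≫ b₁.fst) ≫ δ₀.hom = c₂.fst ≫ b₂.fst
      rw [Category.assoc, hδ₀, ← Category.assoc, hε₀]
    have wδ := w_of_comp hD (c₁ ≫ b₁) (c₂ ≫ b₂) δ₀.hom hδ₀'
    let δ : Y₁ ≅ Y₂ := CFP.isoMk δ₀ (asIso (inv (c₁ ≫ b₁).snd ≫ (c₂ ≫ b₂).snd)) wδ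
    have hsnd : c₁.snd ≫ b₁.snd ≫ a₁.snd = c₂.snd ≫ b₂.snd ≫ a₂.snd :=
      (congrArg CFP.Hom.snd h₁).trans (congrArg CFP.Hom.snd h₂).symm
    refine ⟨ε, δ, comp_liftCod hD c₁ c₂ ε₀.hom hε₀, CFP.hom_ext hδ₀ ?_, CFP.hom_ext hα₀ ?_⟩
    · show b₁.snd ≫ inv (c₁.snd ≫ b₁.snd) ≫ (c₂.snd ≫ b₂.snd) = (inv c₁.snd ≫ c₂.snd) ≫ b₂.snd
      rw [← cancel_epi c₁.snd, ← Category.assoc, IsIso.hom_inv_id_assoc, Category.assoc,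
        IsIso.hom_inv_id_assoc]
    · show a₁.snd = (inv (c₁.snd ≫ b₁.snd) ≫ (c₂.snd ≫ b₂.snd)) ≫ a₂.snd
      rw [← cancel_epi (c₁.snd ≫ b₁.snd)]
      simp only [IsIso.inv_comp, Category.assoc, IsIso.hom_inv_id_assoc]
      exact hsnd
  -- (iv)(b)
  · intro X Y φ hφ
    have h := hF.iv_b φ.fst ((isPullbackMorphism_fiberProduct_iff hF φ).mp hφ)
    exact ⟨(isLBInvertible_fiberProduct_iff hF φ).mpr h.1, h.2⟩
  -- (v)(a)
  · intro X Y φ hφ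
    haveI : IsIso φ.snd := hφ.2
    haveI : Mono φ.fst := hF.v_a φ.fst ((isPreStep_fiberProduct_iff φ hφ.2).mp hφ)
    exact ⟨fun g g' e => CFP.hom_ext ((cancel_mono φ.fst).mp (congrArg CFP.Hom.fst e))
      ((cancel_mono φ.snd).mp (congrArg CFP.Hom.snd e))⟩
  -- (v)(b) existence
  · intro X Y φ hφ
    haveI : IsIso φ.snd := hφ.2
    obtain ⟨B, β₀, α₀, hfac, hβ₀, hα₀⟩ := hF.v_b_exists φ.fst ((isPreStep_fiberProduct_iff φ hφ.2).mp hφ)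
    haveI : IsIso (Base F β₀) := hβ₀.2.2
    let β : X ⟶ liftTgt X β₀ hβ₀.2.2 := liftTgtHom X β₀ hβ₀.2.2
    let α : liftTgt X β₀ hβ₀.2.2 ⟶ Y := liftRest φ β₀ hβ₀.2.2 α₀ hfac
    refine ⟨liftTgt X β₀ hβ₀.2.2, β, α, liftTgtHom_comp_liftRest φ β₀ hβ₀.2.2 α₀ hfac,
      ⟨(isCoAngular_fiberProduct_iff hF β).mpr hβ₀.1, hβ₀.2.1, show IsIso (𝟙 X.snd) from inferInstance⟩,
      (isIsometry_fiberProduct_iff α).mpr hα₀.1, hα₀.2.1, show IsIso φ.snd from inferInstance⟩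
  -- (v)(b) uniqueness
  · intro X Y X₁ X₂ φ β₁ α₁ β₂ α₂ h₁ hβ₁ hα₁ h₂ hβ₂ hα₂
    haveI : IsIso β₁.snd := hβ₁.2.2
    haveI : IsIso β₂.snd := hβ₂.2.2
    have h₁C : β₁.fst ≫ α₁.fst = φ.fst := congrArg CFP.Hom.fst h₁
    have h₂C : β₂.fst ≫ α₂.fst = φ.fst := congrArg CFP.Hom.fst h₂
    obtain ⟨γ₀, hγ₀, hγ₀'⟩ := hF.v_b_unique φ.fst β₁.fst α₁.fst β₂.fst α₂.fst h₁C
      ⟨(isCoAngular_fiberProduct_iff hF β₁).mp hβ₁.1, (isPreStep_fiberProduct_iff β₁ hβ₁.2.2).mp hβ₁.2⟩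
      ⟨(isIsometry_fiberProduct_iff α₁).mp hα₁.1, (isPreStep_fiberProduct_iff α₁ hα₁.2.2).mp hα₁.2⟩
      h₂C
      ⟨(isCoAngular_fiberProduct_iff hF β₂).mp hβ₂.1, (isPreStep_fiberProduct_iff β₂ hβ₂.2.2).mp hβ₂.2⟩
      ⟨(isIsometry_fiberProduct_iff α₂).mp hα₂.1, (isPreStep_fiberProduct_iff α₂ hα₂.2.2).mp hα₂.2⟩
    have hsnd : β₁.snd ≫ α₁.snd = β₂.snd ≫ α₂.snd :=
      (congrArg CFP.Hom.snd h₁).trans (congrArg CFP.Hom.snd h₂).symm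
    refine ⟨CFP.isoMk γ₀ (asIso (inv β₁.snd ≫ β₂.snd)) (w_of_comp hD β₁ β₂ γ₀.hom hγ₀),
      comp_liftCod hD β₁ β₂ γ₀.hom hγ₀, CFP.hom_ext hγ₀' ?_⟩
    show α₁.snd = (inv β₁.snd ≫ β₂.snd) ≫ α₂.snd
    rw [← cancel_epi β₁.snd, Category.assoc, IsIso.hom_inv_id_assoc, hsnd]
  -- (v)(c) existence
  · intro X Y φ hφ
    haveI : IsIso φ.snd := hφ.2
    obtain ⟨B, β₀, α₀, hfac, hβ₀, hα₀⟩ := hF.v_c_exists φ.fst ((isPreStep_fiberProduct_iff φ hφ.2).mp hφ)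
    haveI : IsIso (Base F β₀) := hβ₀.2.2
    let β : X ⟶ liftTgt X β₀ hβ₀.2.2 := liftTgtHom X β₀ hβ₀.2.2
    let α : liftTgt X β₀ hβ₀.2.2 ⟶ Y := liftRest φ β₀ hβ₀.2.2 α₀ hfac
    refine ⟨liftTgt X β₀ hβ₀.2.2, β, α, liftTgtHom_comp_liftRest φ β₀ hβ₀.2.2 α₀ hfac,
      ⟨(isIsometry_fiberProduct_iff β).mpr hβ₀.1, hβ₀.2.1, show IsIso (𝟙 X.snd) from inferInstance⟩,
      (isCoAngular_fiberProduct_iff hF α).mpr hα₀.1, hα₀.2.1, show IsIso φ.snd from inferInstance⟩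
  -- (v)(c) uniqueness
  · intro X Y X₁ X₂ φ β₁ α₁ β₂ α₂ h₁ hβ₁ hα₁ h₂ hβ₂ hα₂
    haveI : IsIso β₁.snd := hβ₁.2.2
    haveI : IsIso β₂.snd := hβ₂.2.2
    have h₁C : β₁.fst ≫ α₁.fst = φ.fst := congrArg CFP.Hom.fst h₁
    have h₂C : β₂.fst ≫ α₂.fst = φ.fst := congrArg CFP.Hom.fst h₂
    obtain ⟨γ₀, hγ₀, hγ₀'⟩ := hF.v_c_unique φ.fst β₁.fst α₁.fst β₂.fst α₂.fst h₁C
      ⟨(isIsometry_fiberProduct_iff β₁).mp hβ₁.1, (isPreStep_fiberProduct_iff β₁ hβ₁.2.2).mp hβ₁.2⟩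
      ⟨(isCoAngular_fiberProduct_iff hF α₁).mp hα₁.1, (isPreStep_fiberProduct_iff α₁ hα₁.2.2).mp hα₁.2⟩
      h₂C
      ⟨(isIsometry_fiberProduct_iff β₂).mp hβ₂.1, (isPreStep_fiberProduct_iff β₂ hβ₂.2.2).mp hβ₂.2⟩
      ⟨(isCoAngular_fiberProduct_iff hF α₂).mp hα₂.1, (isPreStep_fiberProduct_iff α₂ hα₂.2.2).mp hα₂.2⟩
    have hsnd : β₁.snd ≫ α₁.snd = β₂.snd ≫ α₂.snd :=
      (congrArg CFP.Hom.snd h₁).trans (congrArg CFP.Hom.snd h₂).symm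
    refine ⟨CFP.isoMk γ₀ (asIso (inv β₁.snd ≫ β₂.snd)) (w_of_comp hD β₁ β₂ γ₀.hom hγ₀),
      comp_liftCod hD β₁ β₂ γ₀.hom hγ₀, CFP.hom_ext hγ₀' ?_⟩
    show α₁.snd = (inv β₁.snd ≫ β₂.snd) ≫ α₂.snd
    rw [← cancel_epi β₁.snd, Category.assoc, IsIso.hom_inv_id_assoc, hsnd]
  -- (vi)
  · intro X Y φ ψ hφ hψ hb hm
    haveI : IsIso φ.snd := hφ.2.2
    haveI : IsIso ψ.snd := hψ.2.2
    have hφC : IsCoAngularPreStep F φ.fst :=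
      ⟨(isCoAngular_fiberProduct_iff hF φ).mp hφ.1, (isPreStep_fiberProduct_iff φ hφ.2.2).mp hφ.2⟩
    have hψC : IsCoAngularPreStep F ψ.fst :=
      ⟨(isCoAngular_fiberProduct_iff hF ψ).mp hψ.1, (isPreStep_fiberProduct_iff ψ hψ.2.2).mp hψ.2⟩
    have hbC : BaseEquivalent F φ.fst ψ.fst := base_fst_eq_of_snd_eq hb
    have hmC : MetricallyEquivalent F φ.fst ψ.fst := (ElemFrobenioid.pullEquiv Φ X.e.inv).injective hm
    obtain ⟨u, hu, hcomp⟩ := hF.vi φ.fst ψ.fst hφC hψC hbC hmC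
    have hub : Base F u.hom = 𝟙 _ := hu.1
    have w : Base F u.hom ≫ Y.e.hom = Y.e.hom ≫ G.map (𝟙 Y.snd) := by
      rw [hub, G.map_id, Category.id_comp, Category.comp_id]
    have hsnd : ψ.snd = φ.snd := Eq.symm hb
    refine ⟨CFP.isoMk u (Iso.refl Y.snd) w, show _ ∧ _ from ⟨rfl, hu.2⟩, CFP.hom_ext hcomp ?_⟩
    show ψ.snd ≫ 𝟙 Y.snd = φ.snd
    rw [Category.comp_id, hsnd]
  -- (vii)(a)
  · intro X
    obtain ⟨B, h₀, hh₀⟩ := hF.vii_a X.fst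
    haveI : IsIso (Base F h₀) := hh₀.2.1.2
    let H := liftTgt X h₀ hh₀.2.1.2
    let η : X ⟶ H := liftTgtHom X h₀ hh₀.2.1.2
    refine ⟨H, η, (isIsometry_fiberProduct_iff η).mpr hh₀.1,
      ⟨hh₀.2.1.1, show IsIso (𝟙 X.snd) from inferInstance⟩,
      (isIsotropic_fiberProduct_iff H).mpr hh₀.2.2.1, fun Z γ hZ => ?_⟩
    obtain ⟨β₀, hβ₀, huniq⟩ := hh₀.2.2.2 γ.fst ((isIsotropic_fiberProduct_iff Z).mp hZ)
    let β : H ⟶ Z := liftRest γ h₀ hh₀.2.1.2 β₀ hβ₀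
    refine ⟨β, liftTgtHom_comp_liftRest γ h₀ hh₀.2.1.2 β₀ hβ₀, fun β' hβ' => ?_⟩
    refine CFP.hom_ext (huniq β'.fst (congrArg CFP.Hom.fst hβ')) ?_
    show β'.snd = γ.snd
    rw [← congrArg CFP.Hom.snd hβ']
    exact (Category.id_comp _).symm
  -- (vii)(b)
  · intro X Y φ hX
    exact (isIsotropic_fiberProduct_iff Y).mpr (hF.vii_b φ.fst ((isIsotropic_fiberProduct_iff X).mp hX))

/-- **FrdI Prop. 1.6 (ii)** as printed: for `D′` connected and totally epimorphic and `D′ → D`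
mapping FSM-morphisms to FSM-morphisms, `C′ = C ×_D D′ → F_{Φ′}` is a Frobenioid.
[cite: MochizukiFrdI2008, Prop. 1.6] -/
theorem isFrobenioid_fiberProduct (hF : IsFrobenioid F) (hD'c : IsGraphConnected D')
    (hD'e : IsTotallyEpimorphic D') (hG : ∀ {A B : D'} (f : B ⟶ A), IsFSM f → IsFSM (G.map f)) :
    IsFrobenioid (fiberProductFunctor F G) :=
  isFrobenioid_fiberProduct_of_isPreFrobenioid hF (isPreFrobenioid_fiberProduct hF hD'c hD'e hG)

end PreFrobenioid

end Literature.AlgebraicGeometry.Frobenioids
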